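import Literature.AlgebraicGeometry.Motives.CorrespondencesKunneth
import Literature.AlgebraicGeometry.Motives.CorrespondencesTransposeProofs
import Literature.AlgebraicGeometry.Motives.WeilCohomologyProofs
import Literature.AlgebraicGeometry.Motives.VarietiesUnitProofs
import Literature.AlgebraicGeometry.Motives.AbelianVariety
import HarnessLib

/-!
# Künneth components and the coproduct of an abelian variety (Weil cohomology)

For a Weil cohomology theory `W` (Kleiman, *Algebraic cycles and the Weil conjectures* (1968),
§1.2) and smooth projective `X`, `Y`, the Künneth axiom (B) makes
`⨁_{a+b=d} Hᵃ(X) ⊗ Hᵇ(Y) → Hᵈ(X × Y)` an isomorphism; this file names its inverse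
(`kunnethEquiv`, `kunnethComponent`) and records the calculus of Künneth components:
reconstruction and uniqueness, the product of two external products with its Koszul sign, and
the effect of multiplying by `pr₁* w`, `pr₂* w` on the components ("shift lemmas").

For an abelian variety `A` (group law `m : A × A → A`, smooth projective of dimension `g`), the
pull-back `m*` followed by the Künneth decomposition is the **coproduct**
`Δ_{a,b} : Hᵃ⁺ᵇ(A) → Hᵃ(A) ⊗ Hᵇ(A)` making `H•(A)` a graded bialgebra (Kleiman 1968,
Appendix 2A; Mumford, *Abelian Varieties*, §§1, 15 for the classical theories). We prove the
formal properties used downstream (Lieberman–Kleiman theorem `B(A)`, file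
`StandardConjecturesAbelianProofs`):

* `pullback_mul`: for `p q : T ⟶ A`, `(p·q)* x = Σ_{a+b=d} ∪ ∘ (p* ⊗ q*) (Δ_{a,b} x)`;
* counit: `1* = 0` on `Hᵈ(A)`, `d ≥ 1` (the neutral map factors through `Spec k`, whose
  cohomology vanishes in positive degrees), hence `Δ_{d,0} x = x ⊗ 1`, `Δ_{0,d} x = 1 ⊗ x`, and
  degree-one classes are primitive, `m* v = pr₁* v + pr₂* v`;
* cocommutativity `Δ_{b,a} = (-1)^{ab} σ ∘ Δ_{a,b}` (commutativity of `A`) and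
  `Δ_{1,1}(v ∪ w) = v ⊗ w - w ⊗ v` for `v, w ∈ H¹(A)`.

Everything is formal in the axioms of `Literature.AlgebraicGeometry.Motives.WeilCohomology`
(`bijective_kunnethMap`, `map_cup`, `map_one`, `cup_assoc`, `cup_comm`, `one_cup`,
`subsingleton_obj`, `finite_obj`, `bijective_trace`) together with the discharged facts
`IsSmoothProjective.tensor_holds` and `isSmoothProjective_unit_holds`.

## References

* S. Kleiman, *Algebraic cycles and the Weil conjectures*, in: Dix exposés sur la cohomologie
  des schémas, North-Holland (1968), §1.2 (axioms (A), (B)), Appendix 2A (abelian varieties).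
* D. Mumford, *Abelian Varieties*, TIFR Studies in Math. 5, OUP (1970), §1 (the Hopf algebra
  `H•(A)`), §15.
-/

universe u v

open CategoryTheory AlgebraicGeometry MonoidalCategory CartesianMonoidalCategory Opposite
open scoped TensorProduct DirectSum

noncomputable section

namespace Literature.AlgebraicGeometry.Motives

namespace WeilCohomology

variable {k : Type u} [Field k] {K : Type v} [Field K] [CharZero K] (W : WeilCohomology k K)

/-! ## Künneth components -/

section KunnethComponents

variable {n m : ℕ} {X Y : SchemeOver k}

/-- The index of bidegree `(a, b)` in the antidiagonal of `d = a + b`. [folklore] -/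
abbrev kIdx {a b d : ℕ} (h : a + b = d) : ↥(Finset.antidiagonal d) :=
  ⟨(a, b), Finset.mem_antidiagonal.mpr h⟩

/-- The underlying pair of `kIdx h` is `(a, b)`. [folklore] -/
@[simp] lemma kIdx_val {a b d : ℕ} (h : a + b = d) : (kIdx h).1 = (a, b) := rfl

/-- The external product `Hᵃ(X) ⊗ Hᵇ(Y) → Hᵈ(X × Y)`, `x ⊗ y ↦ pr₁* x ∪ pr₂* y`, on the tensor
product (Kleiman 1968 §1.2 (B)). [folklore] -/
def extTensor {a b d : ℕ} (h : a + b = d) : W.obj X a ⊗[K] W.obj Y b →ₗ[K] W.obj (X ⊗ Y) d :=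
  TensorProduct.lift (W.externalCup X Y h)

/-- `extTensor` on an elementary tensor is the external product `pr₁* x ∪ pr₂* y`. [folklore] -/
@[simp]
lemma extTensor_tmul {a b d : ℕ} (h : a + b = d) (x : W.obj X a) (y : W.obj Y b) :
    W.extTensor h (x ⊗ₜ y) = W.externalCup X Y h x y :=
  TensorProduct.lift.tmul _ _

/-- The Künneth map on the summand of bidegree `ij` is the external product. [folklore] -/
lemma kunnethMap_lof {d : ℕ} (ij : ↥(Finset.antidiagonal d)) (t : W.obj X ij.1.1 ⊗[K] W.obj Y ij.1.2) :
    W.kunnethMap X Y d (DirectSum.lof K _ (fun ij : ↥(Finset.antidiagonal d) ↦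
        W.obj X ij.1.1 ⊗[K] W.obj Y ij.1.2) ij t) =
      W.extTensor (Finset.mem_antidiagonal.mp ij.2) t := by
  rw [PreWeilCohomology.kunnethMap, DirectSum.toModule_lof]
  rfl

/-- **The Künneth isomorphism** `⨁_{a+b=d} Hᵃ(X) ⊗ Hᵇ(Y) ≃ Hᵈ(X × Y)` for `X`, `Y` smooth
projective (axiom (B), Kleiman 1968 §1.2). [cite: Kleiman1968AlgebraicCycles, §1.2 (B)] -/
def kunnethEquiv (hX : IsSmoothProjective n X) (hY : IsSmoothProjective m Y) (d : ℕ) :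
    (⨁ ij : ↥(Finset.antidiagonal d), W.obj X ij.1.1 ⊗[K] W.obj Y ij.1.2) ≃ₗ[K]
      W.obj (X ⊗ Y) d :=
  LinearEquiv.ofBijective (W.kunnethMap X Y d) (W.bijective_kunnethMap hX hY d)

/-- The Künneth isomorphism is the Künneth map. [folklore] -/
@[simp]
lemma kunnethEquiv_apply (hX : IsSmoothProjective n X) (hY : IsSmoothProjective m Y) (d : ℕ)
    (t : ⨁ ij : ↥(Finset.antidiagonal d), W.obj X ij.1.1 ⊗[K] W.obj Y ij.1.2) :
    W.kunnethEquiv hX hY d t = W.kunnethMap X Y d t := rfl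

/-- The **Künneth component** of bidegree `(a, b)` of a class on `X × Y` of degree `d = a + b`:
the `(a, b)` coordinate of the inverse Künneth isomorphism (Kleiman 1968 §1.2 (B)). [folklore] -/
def kunnethComponent (hX : IsSmoothProjective n X) (hY : IsSmoothProjective m Y) {d : ℕ}
    (a b : ℕ) (h : a + b = d) : W.obj (X ⊗ Y) d →ₗ[K] W.obj X a ⊗[K] W.obj Y b :=
  (DirectSum.component K (↥(Finset.antidiagonal d))
      (fun ij : ↥(Finset.antidiagonal d) ↦ W.obj X ij.1.1 ⊗[K] W.obj Y ij.1.2) (kIdx h)) ∘ₗ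
    (W.kunnethEquiv hX hY d).symm.toLinearMap

/-- A finite family of tensors, one for each bidegree, assembled by external products and then
decomposed again gives back the family: the Künneth components of `Σ_{ij} extTensor (s ij)` are
the `s ij` (**uniqueness of the Künneth decomposition**). [folklore] -/
lemma kunnethComponent_sum_extTensor (hX : IsSmoothProjective n X) (hY : IsSmoothProjective m Y)
    {d : ℕ} (s : ∀ ij : ↥(Finset.antidiagonal d), W.obj X ij.1.1 ⊗[K] W.obj Y ij.1.2)
    {a b : ℕ} (h : a + b = d) :
    W.kunnethComponent hX hY a b h
        (∑ ij : ↥(Finset.antidiagonal d), W.extTensor (Finset.mem_antidiagonal.mp ij.2) (s ij)) =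
      s (kIdx h) := by
  classical
  have hsum : (∑ ij : ↥(Finset.antidiagonal d), W.extTensor (Finset.mem_antidiagonal.mp ij.2)
      (s ij)) = W.kunnethEquiv hX hY d (∑ ij : ↥(Finset.antidiagonal d),
        DirectSum.lof K _ (fun ij : ↥(Finset.antidiagonal d) ↦
          W.obj X ij.1.1 ⊗[K] W.obj Y ij.1.2) ij (s ij)) := by
    rw [kunnethEquiv_apply, map_sum]
    exact Finset.sum_congr rfl fun ij _ ↦ (W.kunnethMap_lof ij (s ij)).symm
  rw [kunnethComponent, LinearMap.comp_apply, hsum, LinearEquiv.coe_toLinearMap,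
    LinearEquiv.symm_apply_apply, map_sum,
    Finset.sum_eq_single_of_mem (kIdx h) (Finset.mem_univ _)]
  · exact DirectSum.component.lof_self
      (M := fun ij : ↥(Finset.antidiagonal d) ↦ W.obj X ij.1.1 ⊗[K] W.obj Y ij.1.2) K (kIdx h)
      (s (kIdx h))
  · intro ij _ hij
    rw [DirectSum.component.of
      (M := fun ij : ↥(Finset.antidiagonal d) ↦ W.obj X ij.1.1 ⊗[K] W.obj Y ij.1.2) K,
      dif_neg hij]

/-- **Reconstruction**: a class on `X × Y` is the sum of the external products of its Künneth
components, `u = Σ_{a+b=d} ext (u_{a,b})`. [folklore] -/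
lemma sum_extTensor_kunnethComponent (hX : IsSmoothProjective n X) (hY : IsSmoothProjective m Y)
    {d : ℕ} (u : W.obj (X ⊗ Y) d) :
    ∑ ij : ↥(Finset.antidiagonal d), W.extTensor (Finset.mem_antidiagonal.mp ij.2)
        (W.kunnethComponent hX hY ij.1.1 ij.1.2 (Finset.mem_antidiagonal.mp ij.2) u) = u := by
  conv_rhs => rw [← (W.kunnethEquiv hX hY d).apply_symm_apply u,
    ← DirectSum.sum_univ_of (β := fun ij : ↥(Finset.antidiagonal d) ↦
      W.obj X ij.1.1 ⊗[K] W.obj Y ij.1.2) ((W.kunnethEquiv hX hY d).symm u),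
    kunnethEquiv_apply, map_sum]
  refine Finset.sum_congr rfl fun ij _ ↦ ?_
  rw [← DirectSum.lof_eq_of K, W.kunnethMap_lof]
  rfl

/-- Two classes on `X × Y` with the same Künneth components are equal. [folklore] -/
lemma ext_kunnethComponent (hX : IsSmoothProjective n X) (hY : IsSmoothProjective m Y) {d : ℕ}
    {u u' : W.obj (X ⊗ Y) d}
    (h : ∀ (a b : ℕ) (hab : a + b = d),
      W.kunnethComponent hX hY a b hab u = W.kunnethComponent hX hY a b hab u') : u = u' := by
  rw [← W.sum_extTensor_kunnethComponent hX hY u, ← W.sum_extTensor_kunnethComponent hX hY u']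
  exact Finset.sum_congr rfl fun ij _ ↦ by rw [h]

/-- The Künneth component of an external product placed in its own bidegree is the tensor
itself. [folklore] -/
lemma kunnethComponent_extTensor_self (hX : IsSmoothProjective n X) (hY : IsSmoothProjective m Y)
    {a b d : ℕ} (h : a + b = d) (t : W.obj X a ⊗[K] W.obj Y b) :
    W.kunnethComponent hX hY a b h (W.extTensor h t) = t := by
  classical
  let s : ∀ ij : ↥(Finset.antidiagonal d), W.obj X ij.1.1 ⊗[K] W.obj Y ij.1.2 :=
    fun ij ↦ if hij : ij = kIdx h then hij ▸ t else 0
  have hs : (∑ ij : ↥(Finset.antidiagonal d), W.extTensor (Finset.mem_antidiagonal.mp ij.2)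
      (s ij)) = W.extTensor h t := by
    rw [Finset.sum_eq_single_of_mem (kIdx h) (Finset.mem_univ _)]
    · simp only [s, dif_pos]
    · intro ij _ hij
      simp only [s, dif_neg hij, map_zero]
  rw [← hs, W.kunnethComponent_sum_extTensor hX hY s h]
  simp only [s, dif_pos]

/-- The Künneth component of an external product in a different bidegree vanishes. [folklore] -/
lemma kunnethComponent_extTensor_of_ne (hX : IsSmoothProjective n X) (hY : IsSmoothProjective m Y)
    {a b a' b' d : ℕ} (h : a + b = d) (h' : a' + b' = d) (hne : (a, b) ≠ (a', b'))
    (t : W.obj X a' ⊗[K] W.obj Y b') :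
    W.kunnethComponent hX hY a b h (W.extTensor h' t) = 0 := by
  classical
  let s : ∀ ij : ↥(Finset.antidiagonal d), W.obj X ij.1.1 ⊗[K] W.obj Y ij.1.2 :=
    fun ij ↦ if hij : ij = kIdx h' then hij ▸ t else 0
  have hs : (∑ ij : ↥(Finset.antidiagonal d), W.extTensor (Finset.mem_antidiagonal.mp ij.2)
      (s ij)) = W.extTensor h' t := by
    rw [Finset.sum_eq_single_of_mem (kIdx h') (Finset.mem_univ _)]
    · simp only [s, dif_pos]
    · intro ij _ hij
      simp only [s, dif_neg hij, map_zero]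
  have hk : kIdx h ≠ kIdx h' := fun e ↦ hne (by simpa [kIdx] using congrArg Subtype.val e)
  rw [← hs, W.kunnethComponent_sum_extTensor hX hY s h]
  simp only [s, dif_neg hk]

/-- The Künneth component of the external product `pr₁* x ∪ pr₂* y` in its bidegree is
`x ⊗ y`. [folklore] -/
lemma kunnethComponent_externalCup_self (hX : IsSmoothProjective n X)
    (hY : IsSmoothProjective m Y) {a b d : ℕ} (h : a + b = d) (x : W.obj X a) (y : W.obj Y b) :
    W.kunnethComponent hX hY a b h (W.externalCup X Y h x y) = x ⊗ₜ y := by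
  rw [← extTensor_tmul, W.kunnethComponent_extTensor_self hX hY]

/-- The Künneth component of `pr₁* x ∪ pr₂* y` in any other bidegree vanishes. [folklore] -/
lemma kunnethComponent_externalCup_of_ne (hX : IsSmoothProjective n X)
    (hY : IsSmoothProjective m Y) {a b a' b' d : ℕ} (h : a + b = d) (h' : a' + b' = d)
    (hne : (a, b) ≠ (a', b')) (x : W.obj X a') (y : W.obj Y b') :
    W.kunnethComponent hX hY a b h (W.externalCup X Y h' x y) = 0 := by
  rw [← extTensor_tmul, W.kunnethComponent_extTensor_of_ne hX hY h h' hne]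

/-! ### Products of external products -/

/-- The componentwise cup product `(Hⁱ(X) ⊗ Hʲ(Y)) × (Hⁱ'(X) ⊗ Hʲ'(Y)) → Hᵖ(X) ⊗ Hq(Y)`,
`(x ⊗ y, x' ⊗ y') ↦ (x ∪ x') ⊗ (y ∪ y')` (no sign). [folklore] -/
def tensorCup {i j i' j' p q : ℕ} (hp : i + i' = p) (hq : j + j' = q) :
    W.obj X i ⊗[K] W.obj Y j →ₗ[K] W.obj X i' ⊗[K] W.obj Y j' →ₗ[K] W.obj X p ⊗[K] W.obj Y q :=
  TensorProduct.map₂ (W.cup hp) (W.cup hq)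

/-- `tensorCup` on elementary tensors: `(x ⊗ y) · (x' ⊗ y') = (x ∪ x') ⊗ (y ∪ y')`. [folklore] -/
@[simp]
lemma tensorCup_tmul {i j i' j' p q : ℕ} (hp : i + i' = p) (hq : j + j' = q) (x : W.obj X i)
    (y : W.obj Y j) (x' : W.obj X i') (y' : W.obj Y j') :
    W.tensorCup hp hq (x ⊗ₜ y) (x' ⊗ₜ y') = W.cup hp x x' ⊗ₜ W.cup hq y y' := by
  simp [tensorCup]

/-- **Product of two external products** on tensors (graded commutativity on `X × Y`, Koszul
sign): `ext(s) ∪ ext(t) = (-1)^{j i'} ext(s · t)` for `s ∈ Hⁱ(X) ⊗ Hʲ(Y)`,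
`t ∈ Hⁱ'(X) ⊗ Hʲ'(Y)`. [folklore] -/
lemma cup_extTensor_extTensor (hX : IsSmoothProjective n X) (hY : IsSmoothProjective m Y)
    {i j i' j' d d' e p q : ℕ} (h₁ : i + j = d) (h₂ : i' + j' = d') (h : d + d' = e)
    (hp : i + i' = p) (hq : j + j' = q) (h' : p + q = e)
    (s : W.obj X i ⊗[K] W.obj Y j) (t : W.obj X i' ⊗[K] W.obj Y j') :
    W.cup h (W.extTensor h₁ s) (W.extTensor h₂ t) =
      (((j : ℤ) * i').negOnePow : ℤ) • W.extTensor h' (W.tensorCup hp hq s t) := by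
  induction s using TensorProduct.induction_on with
  | zero => simp
  | tmul x y =>
    induction t using TensorProduct.induction_on with
    | zero => simp
    | tmul x' y' =>
      simp only [extTensor_tmul, tensorCup_tmul]
      exact W.cup_externalCup_externalCup hX hY h₁ h₂ h hp hq h' x y x' y'
    | add t t' ht ht' => simp only [map_add, ht, ht', smul_add]
  | add s s' hs hs' => simp only [map_add, LinearMap.add_apply, hs, hs', smul_add]

/-! ### `pr₁* w`, `pr₂* w` as external products; shift lemmas -/

/-- `pr₁* w = pr₁* w ∪ pr₂* 1 = ext(w ⊗ 1)`. [folklore] -/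
lemma pullback_fst_eq_externalCup (hX : IsSmoothProjective n X) (hY : IsSmoothProjective m Y)
    {e : ℕ} (w : W.obj X e) :
    W.pullback (fst X Y) e w = W.externalCup X Y (Nat.add_zero e) w (W.one Y) := by
  have hXY := IsSmoothProjective.tensor_holds hX hY
  rw [externalCup_apply, W.map_one hXY hY (snd X Y), W.cup_one hXY]

/-- `pr₂* w = pr₁* 1 ∪ pr₂* w = ext(1 ⊗ w)`. [folklore] -/
lemma pullback_snd_eq_externalCup (hX : IsSmoothProjective n X) (hY : IsSmoothProjective m Y)
    {e : ℕ} (w : W.obj Y e) :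
    W.pullback (snd X Y) e w = W.externalCup X Y (Nat.zero_add e) (W.one X) w := by
  have hXY := IsSmoothProjective.tensor_holds hX hY
  rw [externalCup_apply, W.map_one hXY hX (fst X Y), W.one_cup hXY]

/-- Right multiplication by `pr₂* w` on an external product:
`ext(s) ∪ pr₂* w = ext((id ⊗ (· ∪ w)) s)` (no sign). [folklore] -/
lemma cup_extTensor_pullback_snd (hX : IsSmoothProjective n X) (hY : IsSmoothProjective m Y)
    {i j d e q f : ℕ} (h₁ : i + j = d) (h : d + e = f) (hq : j + e = q) (h' : i + q = f)
    (s : W.obj X i ⊗[K] W.obj Y j) (w : W.obj Y e) :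
    W.cup h (W.extTensor h₁ s) (W.pullback (snd X Y) e w) =
      W.extTensor h' (LinearMap.lTensor (W.obj X i) ((W.cup hq).flip w) s) := by
  rw [W.pullback_snd_eq_externalCup hX hY w, ← extTensor_tmul,
    W.cup_extTensor_extTensor hX hY h₁ (Nat.zero_add e) h (Nat.add_zero i) hq h']
  simp only [Nat.cast_zero, mul_zero, Int.negOnePow_zero, Units.val_one, one_smul]
  congr 1
  induction s using TensorProduct.induction_on with
  | zero => simp
  | tmul x y => simp [W.cup_one hX]
  | add s s' hs hs' => simp only [map_add, LinearMap.add_apply, hs, hs']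

/-- Right multiplication by `pr₁* w` on an external product:
`ext(s) ∪ pr₁* w = (-1)^{j e} ext(((· ∪ w) ⊗ id) s)` for `s ∈ Hⁱ(X) ⊗ Hʲ(Y)`, `w ∈ Hᵉ(X)`.
[folklore] -/
lemma cup_extTensor_pullback_fst (hX : IsSmoothProjective n X) (hY : IsSmoothProjective m Y)
    {i j d e p f : ℕ} (h₁ : i + j = d) (h : d + e = f) (hp : i + e = p) (h' : p + j = f)
    (s : W.obj X i ⊗[K] W.obj Y j) (w : W.obj X e) :
    W.cup h (W.extTensor h₁ s) (W.pullback (fst X Y) e w) =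
      (((j : ℤ) * e).negOnePow : ℤ) •
        W.extTensor h' (LinearMap.rTensor (W.obj Y j) ((W.cup hp).flip w) s) := by
  rw [W.pullback_fst_eq_externalCup hX hY w, ← extTensor_tmul,
    W.cup_extTensor_extTensor hX hY h₁ (Nat.add_zero e) h hp (Nat.add_zero j) h']
  congr 2
  induction s using TensorProduct.induction_on with
  | zero => simp
  | tmul x y => simp [W.cup_one hY]
  | add s s' hs hs' => simp only [map_add, LinearMap.add_apply, hs, hs']

/-- Left multiplication by `pr₁* w` on an external product:
`pr₁* w ∪ ext(t) = ext(((w ∪ ·) ⊗ id) t)` (no sign). [folklore] -/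
lemma cup_pullback_fst_extTensor (hX : IsSmoothProjective n X) (hY : IsSmoothProjective m Y)
    {i' j' d' e p f : ℕ} (h₂ : i' + j' = d') (h : e + d' = f) (hp : e + i' = p) (h' : p + j' = f)
    (w : W.obj X e) (t : W.obj X i' ⊗[K] W.obj Y j') :
    W.cup h (W.pullback (fst X Y) e w) (W.extTensor h₂ t) =
      W.extTensor h' (LinearMap.rTensor (W.obj Y j') (W.cup hp w) t) := by
  rw [W.pullback_fst_eq_externalCup hX hY w, ← extTensor_tmul,
    W.cup_extTensor_extTensor hX hY (Nat.add_zero e) h₂ h hp (Nat.zero_add j') h']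
  simp only [Nat.cast_zero, zero_mul, Int.negOnePow_zero, Units.val_one, one_smul]
  congr 1
  induction t using TensorProduct.induction_on with
  | zero => simp
  | tmul x y => simp [W.one_cup hY]
  | add s s' hs hs' => simp only [map_add, hs, hs']

/-- Left multiplication by `pr₂* w` on an external product:
`pr₂* w ∪ ext(t) = (-1)^{e i'} ext((id ⊗ (w ∪ ·)) t)` for `t ∈ Hⁱ'(X) ⊗ Hʲ'(Y)`, `w ∈ Hᵉ(Y)`.
[folklore] -/
lemma cup_pullback_snd_extTensor (hX : IsSmoothProjective n X) (hY : IsSmoothProjective m Y)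
    {i' j' d' e q f : ℕ} (h₂ : i' + j' = d') (h : e + d' = f) (hq : e + j' = q) (h' : i' + q = f)
    (w : W.obj Y e) (t : W.obj X i' ⊗[K] W.obj Y j') :
    W.cup h (W.pullback (snd X Y) e w) (W.extTensor h₂ t) =
      (((e : ℤ) * i').negOnePow : ℤ) •
        W.extTensor h' (LinearMap.lTensor (W.obj X i') (W.cup hq w) t) := by
  rw [W.pullback_snd_eq_externalCup hX hY w, ← extTensor_tmul,
    W.cup_extTensor_extTensor hX hY (Nat.zero_add e) h₂ h (Nat.zero_add i') hq h']
  congr 2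
  induction t using TensorProduct.induction_on with
  | zero => simp
  | tmul x y => simp [W.one_cup hX]
  | add s s' hs hs' => simp only [map_add, hs, hs']

/-- **Shift lemma** (right, second factor): the `(a, b + e)` Künneth component of `u ∪ pr₂* w`
is `(id ⊗ (· ∪ w))` of the `(a, b)` component of `u`. [folklore] -/
lemma kunnethComponent_cup_pullback_snd (hX : IsSmoothProjective n X)
    (hY : IsSmoothProjective m Y) {p e f : ℕ} (h : p + e = f) (u : W.obj (X ⊗ Y) p)
    (w : W.obj Y e) {a b q : ℕ} (hab : a + b = p) (hq : b + e = q) (h' : a + q = f) :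
    W.kunnethComponent hX hY a q h' (W.cup h u (W.pullback (snd X Y) e w)) =
      LinearMap.lTensor (W.obj X a) ((W.cup hq).flip w) (W.kunnethComponent hX hY a b hab u) := by
  subst hq
  induction u using W.kunneth_induction hX hY with
  | zero => simp
  | add u u' hu hu' => simp only [map_add, LinearMap.add_apply, hu, hu']
  | ext i j hij x y =>
    rw [← extTensor_tmul, W.cup_extTensor_pullback_snd hX hY hij h (rfl : j + e = j + e)
      (by omega) (x ⊗ₜ y) w]
    by_cases hc : (a, b) = (i, j)
    · obtain ⟨rfl, rfl⟩ := Prod.mk.inj hc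
      rw [W.kunnethComponent_extTensor_self hX hY, W.kunnethComponent_extTensor_self hX hY]
    · rw [W.kunnethComponent_extTensor_of_ne hX hY h' _ (fun hc' ↦ hc ?_),
        W.kunnethComponent_extTensor_of_ne hX hY hab hij hc, map_zero]
      obtain ⟨rfl, h2⟩ := Prod.mk.inj hc'
      exact Prod.ext rfl (by omega)

/-- Shift lemma (right, second factor), vanishing part: the `(a, b')` Künneth components of
`u ∪ pr₂* w` with `b' < deg w` vanish. [folklore] -/
lemma kunnethComponent_cup_pullback_snd_eq_zero (hX : IsSmoothProjective n X)
    (hY : IsSmoothProjective m Y) {p e f : ℕ} (h : p + e = f) (u : W.obj (X ⊗ Y) p)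
    (w : W.obj Y e) {a b' : ℕ} (h' : a + b' = f) (hb : b' < e) :
    W.kunnethComponent hX hY a b' h' (W.cup h u (W.pullback (snd X Y) e w)) = 0 := by
  induction u using W.kunneth_induction hX hY with
  | zero => simp
  | add u u' hu hu' => simp only [map_add, LinearMap.add_apply, hu, hu', add_zero]
  | ext i j hij x y =>
    rw [← extTensor_tmul, W.cup_extTensor_pullback_snd hX hY hij h (rfl : j + e = j + e)
      (by omega) (x ⊗ₜ y) w, W.kunnethComponent_extTensor_of_ne hX hY h' _]
    intro hc
    obtain ⟨-, h2⟩ := Prod.mk.inj hc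
    omega

/-- **Shift lemma** (right, first factor): the `(a + e, b)` Künneth component of `u ∪ pr₁* w`
(`w ∈ Hᵉ(X)`) is `(-1)^{b e} ((· ∪ w) ⊗ id)` of the `(a, b)` component of `u`. [folklore] -/
lemma kunnethComponent_cup_pullback_fst (hX : IsSmoothProjective n X)
    (hY : IsSmoothProjective m Y) {p e f : ℕ} (h : p + e = f) (u : W.obj (X ⊗ Y) p)
    (w : W.obj X e) {a b q : ℕ} (hab : a + b = p) (hq : a + e = q) (h' : q + b = f) :
    W.kunnethComponent hX hY q b h' (W.cup h u (W.pullback (fst X Y) e w)) =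
      (((b : ℤ) * e).negOnePow : ℤ) •
        LinearMap.rTensor (W.obj Y b) ((W.cup hq).flip w) (W.kunnethComponent hX hY a b hab u) := by
  subst hq
  induction u using W.kunneth_induction hX hY with
  | zero => simp
  | add u u' hu hu' => simp only [map_add, LinearMap.add_apply, hu, hu', smul_add]
  | ext i j hij x y =>
    rw [← extTensor_tmul, W.cup_extTensor_pullback_fst hX hY hij h (rfl : i + e = i + e)
      (by omega) (x ⊗ₜ y) w, map_zsmul]
    by_cases hc : (a, b) = (i, j)
    · obtain ⟨rfl, rfl⟩ := Prod.mk.inj hc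
      rw [W.kunnethComponent_extTensor_self hX hY, W.kunnethComponent_extTensor_self hX hY]
    · rw [W.kunnethComponent_extTensor_of_ne hX hY h' _ (fun hc' ↦ hc ?_),
        W.kunnethComponent_extTensor_of_ne hX hY hab hij hc, map_zero, smul_zero, smul_zero]
      obtain ⟨h1, rfl⟩ := Prod.mk.inj hc'
      exact Prod.ext (by omega) rfl

/-- Shift lemma (right, first factor), vanishing part: the `(a', b)` Künneth components of
`u ∪ pr₁* w` with `a' < deg w` vanish. [folklore] -/
lemma kunnethComponent_cup_pullback_fst_eq_zero (hX : IsSmoothProjective n X)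
    (hY : IsSmoothProjective m Y) {p e f : ℕ} (h : p + e = f) (u : W.obj (X ⊗ Y) p)
    (w : W.obj X e) {a' b : ℕ} (h' : a' + b = f) (ha : a' < e) :
    W.kunnethComponent hX hY a' b h' (W.cup h u (W.pullback (fst X Y) e w)) = 0 := by
  induction u using W.kunneth_induction hX hY with
  | zero => simp
  | add u u' hu hu' => simp only [map_add, LinearMap.add_apply, hu, hu', add_zero]
  | ext i j hij x y =>
    rw [← extTensor_tmul, W.cup_extTensor_pullback_fst hX hY hij h (rfl : i + e = i + e)
      (by omega) (x ⊗ₜ y) w, map_zsmul, W.kunnethComponent_extTensor_of_ne hX hY h' _, smul_zero]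
    intro hc
    obtain ⟨h1, -⟩ := Prod.mk.inj hc
    omega

/-- **Shift lemma** (left, first factor): the `(e + a, b)` Künneth component of `pr₁* w ∪ u`
is `((w ∪ ·) ⊗ id)` of the `(a, b)` component of `u` (no sign). [folklore] -/
lemma kunnethComponent_pullback_fst_cup (hX : IsSmoothProjective n X)
    (hY : IsSmoothProjective m Y) {p e f : ℕ} (h : e + p = f) (w : W.obj X e)
    (u : W.obj (X ⊗ Y) p) {a b q : ℕ} (hab : a + b = p) (hq : e + a = q) (h' : q + b = f) :
    W.kunnethComponent hX hY q b h' (W.cup h (W.pullback (fst X Y) e w) u) =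
      LinearMap.rTensor (W.obj Y b) (W.cup hq w) (W.kunnethComponent hX hY a b hab u) := by
  subst hq
  induction u using W.kunneth_induction hX hY with
  | zero => simp
  | add u u' hu hu' => simp only [map_add, hu, hu']
  | ext i j hij x y =>
    rw [← extTensor_tmul, W.cup_pullback_fst_extTensor hX hY hij h (rfl : e + i = e + i)
      (by omega) w (x ⊗ₜ y)]
    by_cases hc : (a, b) = (i, j)
    · obtain ⟨rfl, rfl⟩ := Prod.mk.inj hc
      rw [W.kunnethComponent_extTensor_self hX hY, W.kunnethComponent_extTensor_self hX hY]
    · rw [W.kunnethComponent_extTensor_of_ne hX hY h' _ (fun hc' ↦ hc ?_),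
        W.kunnethComponent_extTensor_of_ne hX hY hab hij hc, map_zero]
      obtain ⟨h1, rfl⟩ := Prod.mk.inj hc'
      exact Prod.ext (by omega) rfl

/-- **Shift lemma** (left, second factor): the `(a, e + b)` Künneth component of `pr₂* w ∪ u`
(`w ∈ Hᵉ(Y)`) is `(-1)^{e a} (id ⊗ (w ∪ ·))` of the `(a, b)` component of `u`. [folklore] -/
lemma kunnethComponent_pullback_snd_cup (hX : IsSmoothProjective n X)
    (hY : IsSmoothProjective m Y) {p e f : ℕ} (h : e + p = f) (w : W.obj Y e)
    (u : W.obj (X ⊗ Y) p) {a b q : ℕ} (hab : a + b = p) (hq : e + b = q) (h' : a + q = f) :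
    W.kunnethComponent hX hY a q h' (W.cup h (W.pullback (snd X Y) e w) u) =
      (((e : ℤ) * a).negOnePow : ℤ) •
        LinearMap.lTensor (W.obj X a) (W.cup hq w) (W.kunnethComponent hX hY a b hab u) := by
  subst hq
  induction u using W.kunneth_induction hX hY with
  | zero => simp
  | add u u' hu hu' => simp only [map_add, hu, hu', smul_add]
  | ext i j hij x y =>
    rw [← extTensor_tmul, W.cup_pullback_snd_extTensor hX hY hij h (rfl : e + j = e + j)
      (by omega) w (x ⊗ₜ y), map_zsmul]
    by_cases hc : (a, b) = (i, j)
    · obtain ⟨rfl, rfl⟩ := Prod.mk.inj hc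
      rw [W.kunnethComponent_extTensor_self hX hY, W.kunnethComponent_extTensor_self hX hY]
    · rw [W.kunnethComponent_extTensor_of_ne hX hY h' _ (fun hc' ↦ hc ?_),
        W.kunnethComponent_extTensor_of_ne hX hY hab hij hc, map_zero, smul_zero, smul_zero]
      obtain ⟨rfl, h2⟩ := Prod.mk.inj hc'
      exact Prod.ext rfl (by omega)

/-! ### `H⁰(X) = K · 1` -/

/-- The unit `1 ∈ H⁰(X)` of a smooth projective `X` is nonzero: `1 ∪ a = a` for all `a`, and
`H²ⁿ(X) ≠ 0` as the trace is onto `K`. [folklore] -/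
lemma unit_ne_zero (hX : IsSmoothProjective n X) : W.one X ≠ 0 := by
  intro h0
  obtain ⟨a, ha⟩ := (W.bijective_trace hX).2 1
  have : a = 0 := by rw [← W.one_cup hX (Nat.zero_add _) a, h0, LinearMap.map_zero₂]
  rw [this, map_zero] at ha
  exact zero_ne_one ha

/-- `H⁰(X) = K · 1` for `X` smooth projective (`dim H⁰ = 1` by Poincaré duality,
`finrank_obj_zero`, and `1 ≠ 0`). [folklore] -/
lemma exists_eq_smul_one (hX : IsSmoothProjective n X) (x : W.obj X 0) :
    ∃ c : K, x = c • W.one X := by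
  haveI := W.finite_obj hX 0
  obtain ⟨c, hc⟩ := (finrank_eq_one_iff_of_nonzero' (W.one X) (W.unit_ne_zero hX)).mp
    (W.finrank_obj_zero hX) x
  exact ⟨c, hc.symm⟩

/-- Every tensor in `M ⊗ H⁰(X)` is of the form `m ⊗ 1`. [folklore] -/
lemma exists_eq_tmul_one (hX : IsSmoothProjective n X) {M : Type*} [AddCommGroup M] [Module K M]
    (t : M ⊗[K] W.obj X 0) : ∃ m : M, t = m ⊗ₜ W.one X := by
  induction t using TensorProduct.induction_on with
  | zero => exact ⟨0, by simp⟩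
  | tmul m x =>
    obtain ⟨c, rfl⟩ := W.exists_eq_smul_one hX x
    exact ⟨c • m, by rw [TensorProduct.tmul_smul, TensorProduct.smul_tmul']⟩
  | add t t' ht ht' =>
    obtain ⟨m, rfl⟩ := ht
    obtain ⟨m', rfl⟩ := ht'
    exact ⟨m + m', by rw [TensorProduct.add_tmul]⟩

/-- Every tensor in `H⁰(X) ⊗ M` is of the form `1 ⊗ m`. [folklore] -/
lemma exists_eq_one_tmul (hX : IsSmoothProjective n X) {M : Type*} [AddCommGroup M] [Module K M]
    (t : W.obj X 0 ⊗[K] M) : ∃ m : M, t = W.one X ⊗ₜ m := by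
  induction t using TensorProduct.induction_on with
  | zero => exact ⟨0, by simp⟩
  | tmul x m =>
    obtain ⟨c, rfl⟩ := W.exists_eq_smul_one hX x
    exact ⟨c • m, by rw [TensorProduct.smul_tmul]⟩
  | add t t' ht ht' =>
    obtain ⟨m, rfl⟩ := ht
    obtain ⟨m', rfl⟩ := ht'
    exact ⟨m + m', by rw [TensorProduct.tmul_add]⟩

end KunnethComponents

/-! ## The coproduct of an abelian variety -/

section AbelianVariety

open scoped MonObj

variable {g : ℕ} (A : AbelianVariety k)

/-- The **coproduct** `Δ_{a,b} : Hᵈ(A) → Hᵃ(A) ⊗ Hᵇ(A)` (`a + b = d`) of the cohomology of an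
abelian variety: pull-back along the group law `m : A × A → A` followed by the Künneth
component of bidegree `(a, b)` (Mumford, *Abelian Varieties* §1; Kleiman 1968, 2A).
[cite: MumfordAV1970, §1] -/
def coprod (hA : IsSmoothProjective g A.X) {d : ℕ} (a b : ℕ) (h : a + b = d) :
    W.obj A.X d →ₗ[K] W.obj A.X a ⊗[K] W.obj A.X b :=
  W.kunnethComponent hA hA a b h ∘ₗ W.pullback μ[A.X] d

/-- `Δ_{a,b} x` is the `(a, b)` Künneth component of `m* x`. [folklore] -/
lemma coprod_apply (hA : IsSmoothProjective g A.X) {d : ℕ} (a b : ℕ) (h : a + b = d)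
    (x : W.obj A.X d) :
    W.coprod A hA a b h x = W.kunnethComponent hA hA a b h (W.pullback μ[A.X] d x) := rfl

/-- Reconstruction of `m* x` from the coproduct: `m* x = Σ_{a+b=d} ext (Δ_{a,b} x)`. [folklore] -/
lemma sum_extTensor_coprod (hA : IsSmoothProjective g A.X) {d : ℕ} (x : W.obj A.X d) :
    ∑ ij : ↥(Finset.antidiagonal d), W.extTensor (Finset.mem_antidiagonal.mp ij.2)
        (W.coprod A hA ij.1.1 ij.1.2 (Finset.mem_antidiagonal.mp ij.2) x) =
      W.pullback μ[A.X] d x :=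
  W.sum_extTensor_kunnethComponent hA hA _

variable {T : SchemeOver k} {t : ℕ}

/-- The "convolution term" `Hᵃ(A) ⊗ Hᵇ(A) → Hᵈ(T)`, `x ⊗ y ↦ p* x ∪ q* y`, for two
`T`-valued points `p q : T ⟶ A`. [folklore] -/
def mulPullback (p q : T ⟶ A.X) {a b d : ℕ} (h : a + b = d) :
    W.obj A.X a ⊗[K] W.obj A.X b →ₗ[K] W.obj T d :=
  TensorProduct.lift ((W.cup h).compl₁₂ (W.pullback p a) (W.pullback q b))

/-- `mulPullback` on an elementary tensor: `x ⊗ y ↦ p* x ∪ q* y`. [folklore] -/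
@[simp]
lemma mulPullback_tmul (p q : T ⟶ A.X) {a b d : ℕ} (h : a + b = d) (x : W.obj A.X a)
    (y : W.obj A.X b) :
    W.mulPullback A p q h (x ⊗ₜ y) = W.cup h (W.pullback p a x) (W.pullback q b y) := by
  simp [mulPullback]

/-- Pull-back along `⟨p, q⟩ : T → A × A` of an external product of tensors:
`⟨p, q⟩* ext(s) = (∪ ∘ (p* ⊗ q*)) s`. [folklore] -/
lemma pullback_lift_extTensor (hA : IsSmoothProjective g A.X) (hT : IsSmoothProjective t T)
    (p q : T ⟶ A.X) {a b d : ℕ} (h : a + b = d) (s : W.obj A.X a ⊗[K] W.obj A.X b) :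
    W.pullback (lift p q) d (W.extTensor h s) = W.mulPullback A p q h s := by
  have hAA := IsSmoothProjective.tensor_holds hA hA
  induction s using TensorProduct.induction_on with
  | zero => simp
  | tmul x y =>
    rw [extTensor_tmul, W.pullback_externalCup hT hAA (lift p q) h x y, lift_fst, lift_snd,
      mulPullback_tmul]
  | add s s' hs hs' => simp only [map_add, hs, hs']

/-- **Pull-back along a product of points is convolution**: for `p q : T ⟶ A` (product taken in
the group `A(T)`), `(p · q)* x = Σ_{a+b=d} p* x₍ₐ₎ ∪ q* x₍ᵦ₎` in Sweedler-like notation, i.e.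
`Σ_{a+b=d} (∪ ∘ (p* ⊗ q*)) (Δ_{a,b} x)` (Mumford §1: `(f + g)* ` via `m*` and Künneth).
[cite: MumfordAV1970, §1] -/
theorem pullback_mul (hA : IsSmoothProjective g A.X) (hT : IsSmoothProjective t T)
    (p q : T ⟶ A.X) {d : ℕ} (x : W.obj A.X d) :
    W.pullback (p * q) d x =
      ∑ ij : ↥(Finset.antidiagonal d), W.mulPullback A p q (Finset.mem_antidiagonal.mp ij.2)
        (W.coprod A hA ij.1.1 ij.1.2 (Finset.mem_antidiagonal.mp ij.2) x) := by
  rw [Hom.mul_def, W.pullback_comp, LinearMap.comp_apply, ← W.sum_extTensor_coprod A hA x,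
    map_sum]
  exact Finset.sum_congr rfl fun ij _ ↦ W.pullback_lift_extTensor A hA hT p q _ _

/-! ### The counit: pull-back along the neutral point -/

/-- **The neutral `T`-point kills positive-degree cohomology**: `1* x = 0` for `x ∈ Hᵈ(A)`,
`d ≠ 0`, since `1 = (T → Spec k → A)` and `Hᵈ(Spec k) = 0` (`Spec k` is smooth projective of
dimension `0`, `isSmoothProjective_unit_holds`, and axiom (A)). [folklore] -/
theorem pullback_one_eq_zero {d : ℕ} (hd : d ≠ 0) (x : W.obj A.X d) :
    W.pullback (1 : T ⟶ A.X) d x = 0 := by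
  haveI := W.subsingleton_obj (isSmoothProjective_unit_holds k) (i := d) (by omega)
  rw [Hom.one_def, W.pullback_comp, LinearMap.comp_apply,
    Subsingleton.elim (W.pullback η[A.X] d x) 0, map_zero]

/-- `1* 1 = 1` in degree `0`. [folklore] -/
theorem pullback_one_one (hA : IsSmoothProjective g A.X) (hT : IsSmoothProjective t T) :
    W.pullback (1 : T ⟶ A.X) 0 (W.one A.X) = W.one T :=
  W.map_one hT hA _

/-- On positive-degree summands the convolution term with the neutral point on the right
vanishes: `(∪ ∘ (p* ⊗ 1*)) = 0` on `Hᵃ ⊗ Hᵇ`, `b ≠ 0`. [folklore] -/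
lemma mulPullback_one_right_eq_zero (p : T ⟶ A.X) {a b d : ℕ} (h : a + b = d) (hb : b ≠ 0)
    (s : W.obj A.X a ⊗[K] W.obj A.X b) : W.mulPullback A p 1 h s = 0 := by
  induction s using TensorProduct.induction_on with
  | zero => simp
  | tmul x y => rw [mulPullback_tmul, W.pullback_one_eq_zero A hb, LinearMap.map_zero]
  | add s s' hs hs' => rw [map_add, hs, hs', add_zero]

/-- On positive-degree summands the convolution term with the neutral point on the left
vanishes: `(∪ ∘ (1* ⊗ q*)) = 0` on `Hᵃ ⊗ Hᵇ`, `a ≠ 0`. [folklore] -/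
lemma mulPullback_one_left_eq_zero (q : T ⟶ A.X) {a b d : ℕ} (h : a + b = d) (ha : a ≠ 0)
    (s : W.obj A.X a ⊗[K] W.obj A.X b) : W.mulPullback A 1 q h s = 0 := by
  induction s using TensorProduct.induction_on with
  | zero => simp
  | tmul x y => rw [mulPullback_tmul, W.pullback_one_eq_zero A ha, LinearMap.map_zero₂]
  | add s s' hs hs' => rw [map_add, hs, hs', add_zero]

/-- **Counit, right**: `Δ_{d,0} x = x ⊗ 1` (from `𝟙 · 1 = 𝟙` in `A(A)`, `1* = 0` in positive
degrees and `H⁰(A) = K · 1`). [cite: MumfordAV1970, §1] -/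
theorem coprod_self_zero (hA : IsSmoothProjective g A.X) {d : ℕ} (x : W.obj A.X d) :
    W.coprod A hA d 0 (Nat.add_zero d) x = x ⊗ₜ W.one A.X := by
  obtain ⟨x', hx'⟩ := W.exists_eq_tmul_one hA (W.coprod A hA d 0 (Nat.add_zero d) x)
  have key : W.pullback ((𝟙 A.X) * 1) d x = x' := by
    rw [W.pullback_mul A hA hA (𝟙 A.X) 1 x,
      Finset.sum_eq_single_of_mem (kIdx (Nat.add_zero d)) (Finset.mem_univ _)]
    · change W.mulPullback A (𝟙 A.X) 1 (Nat.add_zero d) (W.coprod A hA d 0 (Nat.add_zero d) x) = x'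
      rw [hx', mulPullback_tmul, W.pullback_one_one A hA hA, W.pullback_id, LinearMap.id_apply,
        W.cup_one hA]
    · intro ij _ hij
      apply W.mulPullback_one_right_eq_zero A
      intro h0
      apply hij
      have h1 := Finset.mem_antidiagonal.mp ij.2
      exact Subtype.ext (Prod.ext (by simp; omega) h0)
  rw [mul_one, W.pullback_id, LinearMap.id_apply] at key
  rw [hx', key]

/-- **Counit, left**: `Δ_{0,d} x = 1 ⊗ x`. [cite: MumfordAV1970, §1] -/
theorem coprod_zero_self (hA : IsSmoothProjective g A.X) {d : ℕ} (x : W.obj A.X d) :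
    W.coprod A hA 0 d (Nat.zero_add d) x = W.one A.X ⊗ₜ x := by
  obtain ⟨x', hx'⟩ := W.exists_eq_one_tmul hA (W.coprod A hA 0 d (Nat.zero_add d) x)
  have key : W.pullback (1 * (𝟙 A.X)) d x = x' := by
    rw [W.pullback_mul A hA hA 1 (𝟙 A.X) x,
      Finset.sum_eq_single_of_mem (kIdx (Nat.zero_add d)) (Finset.mem_univ _)]
    · change W.mulPullback A 1 (𝟙 A.X) (Nat.zero_add d) (W.coprod A hA 0 d (Nat.zero_add d) x) = x'
      rw [hx', mulPullback_tmul, W.pullback_one_one A hA hA, W.pullback_id, LinearMap.id_apply,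
        W.one_cup hA]
    · intro ij _ hij
      apply W.mulPullback_one_left_eq_zero A
      intro h0
      apply hij
      have h1 := Finset.mem_antidiagonal.mp ij.2
      exact Subtype.ext (Prod.ext h0 (by simp; omega))
  rw [one_mul, W.pullback_id, LinearMap.id_apply] at key
  rw [hx', key]

/-- **Primitive classes**: if all the middle coproduct components `Δ_{a,b} x`, `0 < a, b`, of a
positive-degree class `x` vanish, then `m* x = pr₁* x + pr₂* x`. In particular every class of
degree `1` is primitive (`pullback_mul_of_deg_one`). [cite: MumfordAV1970, §1] -/
theorem pullback_mu_eq_of_coprod_eq_zero (hA : IsSmoothProjective g A.X) {d : ℕ} (hd : d ≠ 0)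
    (x : W.obj A.X d)
    (hx : ∀ (a b : ℕ) (h : a + b = d), a ≠ 0 → b ≠ 0 → W.coprod A hA a b h x = 0) :
    W.pullback μ[A.X] d x =
      W.pullback (fst A.X A.X) d x + W.pullback (snd A.X A.X) d x := by
  rw [← W.sum_extTensor_coprod A hA x]
  have hne : kIdx (Nat.add_zero d) ≠ kIdx (Nat.zero_add d) := by
    intro e
    have := congrArg (fun ij ↦ ij.1.1) e
    simp at this
    exact hd this
  rw [Finset.sum_eq_add (kIdx (Nat.add_zero d)) (kIdx (Nat.zero_add d)) hne]
  · change W.extTensor (Nat.add_zero d) (W.coprod A hA d 0 (Nat.add_zero d) x) +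
        W.extTensor (Nat.zero_add d) (W.coprod A hA 0 d (Nat.zero_add d) x) = _
    rw [W.coprod_self_zero A hA, W.coprod_zero_self A hA, extTensor_tmul, extTensor_tmul,
      ← W.pullback_fst_eq_externalCup hA hA, ← W.pullback_snd_eq_externalCup hA hA]
  · intro ij _ hij
    have h1 := Finset.mem_antidiagonal.mp ij.2
    rw [hx _ _ _ ?_ ?_, map_zero]
    · intro h0
      apply hij.2
      exact Subtype.ext (Prod.ext h0 (by simp; omega))
    · intro h0
      apply hij.1
      exact Subtype.ext (Prod.ext (by simp; omega) h0)
  · exact fun h ↦ (h (Finset.mem_univ _)).elim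
  · exact fun h ↦ (h (Finset.mem_univ _)).elim

/-- **Degree-one classes are primitive**: `m* v = pr₁* v + pr₂* v` for `v ∈ H¹(A)`.
[cite: MumfordAV1970, §1] -/
theorem pullback_mu_of_deg_one (hA : IsSmoothProjective g A.X) (v : W.obj A.X 1) :
    W.pullback μ[A.X] 1 v = W.pullback (fst A.X A.X) 1 v + W.pullback (snd A.X A.X) 1 v :=
  W.pullback_mu_eq_of_coprod_eq_zero A hA Nat.one_ne_zero v fun a b h ha hb ↦ by omega

/-! ### Cocommutativity and the coproduct of a product of degree-one classes -/

/-- **Cocommutativity**: `Δ_{b,a} x = (-1)^{ab} σ(Δ_{a,b} x)`, `σ` the flip of tensor factors,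
because the group law of an abelian variety is commutative (`σ_{A,A} ≫ m = m`, Mumford §4) and
the swap acts on external products by the Koszul sign (`transposeClass_externalCup`).
[cite: MumfordAV1970, §4 Cor. 2 (commutativity)] -/
theorem coprod_comm (hA : IsSmoothProjective g A.X) {d a b : ℕ} (h : a + b = d) (h' : b + a = d)
    (x : W.obj A.X d) :
    W.coprod A hA b a h' x =
      (((a : ℤ) * b).negOnePow : ℤ) • TensorProduct.comm K _ _ (W.coprod A hA a b h x) := by
  -- `m* x = σ* m* x = Σ (-1)^{ab} ext_{b,a} (flip Δ_{a,b} x)`; compare `(b, a)` components.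
  have hμ : W.pullback μ[A.X] d x = W.transposeClass (W.pullback μ[A.X] d x) := by
    rw [PreWeilCohomology.transposeClass, ← LinearMap.comp_apply, ← W.pullback_comp,
      IsCommMonObj.mul_comm]
  have hexp : W.transposeClass (W.pullback μ[A.X] d x) =
      ∑ ij : ↥(Finset.antidiagonal d), (((ij.1.1 : ℤ) * ij.1.2).negOnePow : ℤ) •
        W.extTensor (show ij.1.2 + ij.1.1 = d by have := Finset.mem_antidiagonal.mp ij.2; omega)
          (TensorProduct.comm K _ _
            (W.coprod A hA ij.1.1 ij.1.2 (Finset.mem_antidiagonal.mp ij.2) x)) := by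
    conv_lhs => rw [← W.sum_extTensor_coprod A hA x]
    rw [PreWeilCohomology.transposeClass, map_sum]
    refine Finset.sum_congr rfl fun ij _ ↦ ?_
    generalize W.coprod A hA ij.1.1 ij.1.2 (Finset.mem_antidiagonal.mp ij.2) x = s
    induction s using TensorProduct.induction_on with
    | zero => simp
    | tmul y z =>
      rw [extTensor_tmul]
      change W.transposeClass _ = _
      rw [W.transposeClass_externalCup hA hA _
        (by have := Finset.mem_antidiagonal.mp ij.2; omega)]
      simp
    | add s s' hs hs' => simp only [map_add, hs, hs', smul_add]
  -- take the `(b, a)` component of both sides of `hμ`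
  have := congrArg (W.kunnethComponent hA hA b a h') hμ
  rw [hexp, map_sum] at this
  rw [coprod_apply, this, Finset.sum_eq_single_of_mem (kIdx h) (Finset.mem_univ _)]
  · rw [map_zsmul]
    change _ • W.kunnethComponent hA hA b a h' (W.extTensor _
      (TensorProduct.comm K _ _ (W.coprod A hA a b h x))) = _
    rw [W.kunnethComponent_extTensor_self hA hA]
  · intro ij _ hij
    have h1 := Finset.mem_antidiagonal.mp ij.2
    rw [map_zsmul, W.kunnethComponent_extTensor_of_ne hA hA h' _ ?_, smul_zero]
    intro hc
    obtain ⟨h2, h3⟩ := Prod.mk.inj hc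
    exact hij (Subtype.ext (Prod.ext h3.symm h2.symm))

/-- **The coproduct of a product of two degree-one classes**:
`Δ_{1,1}(v ∪ w) = v ⊗ w - w ⊗ v` for `v, w ∈ H¹(A)` (`m*` is a ring homomorphism, `v`, `w` are
primitive, and `pr₂* v ∪ pr₁* w = - pr₁* w ∪ pr₂* v`). [cite: MumfordAV1970, §1] -/
theorem coprod_one_one_cup (hA : IsSmoothProjective g A.X) (v w : W.obj A.X 1) :
    W.coprod A hA 1 1 rfl (W.cup (rfl : 1 + 1 = 2) v w) = v ⊗ₜ w - w ⊗ₜ v := by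
  have hAA := IsSmoothProjective.tensor_holds hA hA
  rw [coprod_apply, W.map_cup hAA hA μ[A.X] rfl v w, W.pullback_mu_of_deg_one A hA v,
    W.pullback_mu_of_deg_one A hA w, LinearMap.map_add₂, map_add, map_add, map_add, map_add,
    map_add]
  -- the four terms
  have e1 : W.kunnethComponent hA hA 1 1 rfl (W.cup (rfl : 1 + 1 = 2)
      (W.pullback (fst A.X A.X) 1 v) (W.pullback (fst A.X A.X) 1 w)) = 0 := by
    rw [← W.map_cup hAA hA (fst A.X A.X) rfl v w, W.pullback_fst_eq_externalCup hA hA,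
      W.kunnethComponent_externalCup_of_ne hA hA]
    simp
  have e2 : W.kunnethComponent hA hA 1 1 rfl (W.cup (rfl : 1 + 1 = 2)
      (W.pullback (fst A.X A.X) 1 v) (W.pullback (snd A.X A.X) 1 w)) = v ⊗ₜ w := by
    rw [← externalCup_apply, W.kunnethComponent_externalCup_self hA hA]
  have e3 : W.kunnethComponent hA hA 1 1 rfl (W.cup (rfl : 1 + 1 = 2)
      (W.pullback (snd A.X A.X) 1 v) (W.pullback (fst A.X A.X) 1 w)) = -(w ⊗ₜ v) := by
    rw [W.cup_comm hAA rfl rfl, ← externalCup_apply, map_zsmul,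
      W.kunnethComponent_externalCup_self hA hA]
    simp
  have e4 : W.kunnethComponent hA hA 1 1 rfl (W.cup (rfl : 1 + 1 = 2)
      (W.pullback (snd A.X A.X) 1 v) (W.pullback (snd A.X A.X) 1 w)) = 0 := by
    rw [← W.map_cup hAA hA (snd A.X A.X) rfl v w, W.pullback_snd_eq_externalCup hA hA,
      W.kunnethComponent_externalCup_of_ne hA hA]
    simp
  rw [e1, e2, e3, e4]
  abel

end AbelianVariety

end WeilCohomology

end Literature.AlgebraicGeometry.Motives

end
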